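import Summits.Ventures.PercRepro.S2SixteenCaps
import Summits.Ventures.PercRepro.S2FlatSharp
import Summits.Ventures.PercRepro.S2TailFlats
import Summits.Ventures.PercRepro.S2SpanningCount
import Summits.Ventures.PercRepro.S2DirectCell
import Summits.Ventures.PercRepro.S2DichotomyTools
import Summits.Ventures.PercRepro.RankLevelSetPlaneTenPrime

/-!
# PercRepro — S2: THE CASES `ν = 14, 15` OF THE COLOOP-FREE CELL `(13, 16)` BY THE FLAT-SHARP LEVER (p7, gen 19; sub-claim S2; the row `p = 13`)

On the coloop-free cell `(13, 16)` (an `e`-free core of rank `13` on `29` points; caps `54 / 767 / 9468`), each regime `ν` (a set of nullity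
`ν` on `≤ ν + 5` points — `≤ 21` at the top `ν = 15` — and none of nullity `ν + 1` on `≤ ν + 6`) by the flat-sharp lever `topCount_le_flat_sharp`
at `(min (ν + 5) 19, min (ν + 4) 10)` (the regime's flat bounds or the universal core bounds `19 / 10`), the tail by flats at the same caps and the
spanning count through the set (`S2.ncard_spanning_le_of_nullity`), closed by the direct cell inequality `Φ·U + A + S ≤ 2^n` or the key form
`Φ·U + A ≤ Σ_{s=6}^{p−1} C(n, s)` (S2DirectCell). Ratios `0.638`, `0.618`. Nothing about the cell is claimed. Axioms: standard.
-/

open scoped Matroid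

namespace PercRepro

namespace ThmN

open Set

variable {α : Type}

/-- **The case `ν = 14` of the coloop-free cell `(13, 16)`**: a set of nullity `14` on `≤ 19` points, none of nullity `15` on `≤ 21`, by the
flat-sharp lever at `(19, 10)` and the spanning count through the set (`#U ≤ 305390483071835299 / 27948903675`, `A = 752669930080854896417 / 67580449086150`, `S ≤ 29121717`; the direct cell inequality, ratio `0.638`). -/
theorem c025_thirteen_sixteen_cf_nu_fourteen (M : Matroid α) [M.Finite]
    (hR : M.eRank = ((13 : ℕ) : ℕ∞)) (hn : M.E.ncard = 13 + 16)
    (hfree : ∀ e ∈ M.E, ∃ A ⊆ M.E \ {e}, e ∉ M.closure A ∧ e ∉ M.closure ((M.E \ {e}) \ A)) (hK : ∀ e, ¬ M.IsColoop e)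
    (h15 : ¬ ∃ W ⊆ M.E, W.ncard ≤ 21 ∧ W.encard = M.eRk W + 15)
    (h14 : ∃ W ⊆ M.E, W.ncard ≤ 19 ∧ W.encard = M.eRk W + 14) :
    RLS M 13 5 := by
  classical
  have hd : M.E.encard = M.eRank + ((16 : ℕ) : ℕ∞) := by
    rw [hR, ← M.ground_finite.cast_ncard_eq, hn]
    push_cast
    ring
  obtain ⟨hs3, hs4, hs5⟩ := caps_thirteen_sixteen_cf M hd hn hfree hK
  have hflat : ∀ X ⊆ M.E, M.eRk X ≤ 5 → X.ncard ≤ 19 := fun X hX hr => by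
    have := S2.ncard_le_of_eRk_le_of_not_nullity M 15 21 (by norm_num) h15 hX (r := 5) (by norm_num) (by exact_mod_cast hr)
    omega
  have hflat' : ∀ X ⊆ M.E, M.eRk X ≤ 4 → X.ncard ≤ 10 := fun X hX hr => ncard_le_ten_of_eRk_le_four_of_free M hfree hX hr
  have hU := topCount_le_flat_sharp M 13 16 (by norm_num) (by norm_num) hR hn hfree 19 10 hflat hflat' (by norm_num) (by norm_num)
    54 767 9468 hs3 hs4 hs5
  have hA := ncard_eRk_le_five_le_flats M 13 16 (by norm_num) hR hn hfree 19 10 hflat hflat' (by norm_num) (by norm_num)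
    (by norm_num) (by norm_num) 54 767 9468 hs3 hs4 hs5
  obtain ⟨W, hW, hWn, hWk⟩ := h14
  have hS' : {X : Set α | X ⊆ M.E ∧ M.eRk X = M.eRank}.ncard ≤ 29121717 := by
    refine (S2.ncard_spanning_le_of_nullity M hW hd hWk).trans ?_
    rw [hn]
    generalize W.ncard = w at hWn ⊢
    interval_cases w <;> decide
  have hSq : ({X : Set α | X ⊆ M.E ∧ M.eRk X = M.eRank}.ncard : ℚ) ≤ 29121717 := by exact_mod_cast hS'
  rw [RLS_iff]
  refine c025_core_five_cell_direct M 13 16 hR hn _ hU _ hA 29121717 hSq (phiK 13 5) (by rw [phiK_thirteen_five]; norm_num) ?_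
  rw [phiK_thirteen_five]
  norm_num [Finset.sum_range_succ, Finset.sum_Icc_succ_top, Nat.choose]

/-- **The case `ν = 15` of the coloop-free cell `(13, 16)`**: a set of nullity `15` on `≤ 21` points, by the
flat-sharp lever at `(19, 10)` and the spanning count through the set (`#U ≤ 305390483071835299 / 27948903675`, `A = 752669930080854896417 / 67580449086150`, `S ≤ 18643653`; the direct cell inequality, ratio `0.618`). -/
theorem c025_thirteen_sixteen_cf_nu_fifteen (M : Matroid α) [M.Finite]
    (hR : M.eRank = ((13 : ℕ) : ℕ∞)) (hn : M.E.ncard = 13 + 16)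
    (hfree : ∀ e ∈ M.E, ∃ A ⊆ M.E \ {e}, e ∉ M.closure A ∧ e ∉ M.closure ((M.E \ {e}) \ A)) (hK : ∀ e, ¬ M.IsColoop e)
    (h15 : ∃ W ⊆ M.E, W.ncard ≤ 21 ∧ W.encard = M.eRk W + 15) :
    RLS M 13 5 := by
  classical
  have hd : M.E.encard = M.eRank + ((16 : ℕ) : ℕ∞) := by
    rw [hR, ← M.ground_finite.cast_ncard_eq, hn]
    push_cast
    ring
  obtain ⟨hs3, hs4, hs5⟩ := caps_thirteen_sixteen_cf M hd hn hfree hK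
  have hflat : ∀ X ⊆ M.E, M.eRk X ≤ 5 → X.ncard ≤ 19 := fun X hX hr => ncard_le_nineteen_of_eRk_le_five_of_free M hfree hX hr
  have hflat' : ∀ X ⊆ M.E, M.eRk X ≤ 4 → X.ncard ≤ 10 := fun X hX hr => ncard_le_ten_of_eRk_le_four_of_free M hfree hX hr
  have hU := topCount_le_flat_sharp M 13 16 (by norm_num) (by norm_num) hR hn hfree 19 10 hflat hflat' (by norm_num) (by norm_num)
    54 767 9468 hs3 hs4 hs5
  have hA := ncard_eRk_le_five_le_flats M 13 16 (by norm_num) hR hn hfree 19 10 hflat hflat' (by norm_num) (by norm_num)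
    (by norm_num) (by norm_num) 54 767 9468 hs3 hs4 hs5
  obtain ⟨W, hW, hWn, hWk⟩ := h15
  have hS' : {X : Set α | X ⊆ M.E ∧ M.eRk X = M.eRank}.ncard ≤ 18643653 := by
    refine (S2.ncard_spanning_le_of_nullity M hW hd hWk).trans ?_
    rw [hn]
    generalize W.ncard = w at hWn ⊢
    interval_cases w <;> decide
  have hSq : ({X : Set α | X ⊆ M.E ∧ M.eRk X = M.eRank}.ncard : ℚ) ≤ 18643653 := by exact_mod_cast hS'
  rw [RLS_iff]
  refine c025_core_five_cell_direct M 13 16 hR hn _ hU _ hA 18643653 hSq (phiK 13 5) (by rw [phiK_thirteen_five]; norm_num) ?_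
  rw [phiK_thirteen_five]
  norm_num [Finset.sum_range_succ, Finset.sum_Icc_succ_top, Nat.choose]


end ThmN

end PercRepro
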